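import Literature.NumberTheory.NumberFields.ClassNumberPExtensionOnePrime
import Literature.NumberTheory.NumberFields.BigHilbertClassFieldOfGaloisExtension
import Literature.NumberTheory.NumberFields.UnramifiedHomsOddNarrowClassNumber
import HarnessLib

/-!
# `p`-extensions ramified at one FINITE prime: `p ∣ h⁺_L ⟹ p ∣ h⁺_K` — Washington's Thm. 10.4 for the NARROW class number, with NO
# condition at the infinite places (proved; no definition, no named fact)

Topic `NumberTheory/NumberFields` (class field theory); namespace `Literature.NumberTheory.NumberFields`.  Theorem-only file, written by the
prover seat `cruxlead-stmt-BirchSwinnertonDyer-19573-w2` GEN 8 (cell `bsd-2adic`; `--supports` stmt-BirchSwinnertonDyer-19573; closes nothing).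
It is the NARROW twin of `ClassNumberPExtensionOnePrime.lean` (Washington Thm. 10.4, whose §3 is followed line by line): the big (narrow)
Hilbert class field `K¹(L)` (`narrowRayClassField L ⊤`, degree `h⁺(L)`, Galois over `K` by `BigHilbertClassFieldOfGaloisExtension.lean`)
replaces the Hilbert class field, and the final count is by `h⁺(K)` (tree `finrank_dvd_narrowClassNumber_of_isUnramifiedIn`: an abelian
extension unramified at every FINITE prime has degree dividing the narrow class number).  Because the big Hilbert class field tolerates
ramification at the real places, the hypothesis «`L/K` unramified at the infinite places» of the wide statement DISAPPEARS: the theorem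
applies to `p = 2` and a totally real `K` with `L` of any signature — e.g. the layers of the cyclotomic `ℤ₂`-extension of a totally real
field (`NarrowClassNumberOnePrimeTower.lean`: `h⁺(K)` odd and ONE prime above `2` ⟹ `h⁺(K_n)` odd for all `n`, the narrow form of
Iwasawa 1956 / Washington Prop. 13.22; at `K = ℚ` this is Weber's theorem).

> Washington, Thm. 10.4, proof, read with `H` := the maximal abelian `p`-extension of `L` unramified at all FINITE primes: `H/K` is Galois;
> the inertia group of the one ramified prime meets `Gal(H/L)` trivially, so it is a proper subgroup of the `p`-group `G = Gal(H/K)`; it lies in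
> a normal subgroup `N` of index `p` containing all inertia groups; `H^N/K` is abelian of degree `p`, unramified at every finite prime, so
> `p ∣ h⁺(K)`.  (Greenberg, LNM 1716, p. 122, uses exactly this narrow object over the layers `ℚ_n`.)

## Main results

* `dvd_narrowClassNumber_of_normal_of_inertia_le` — `E/K` finite Galois, `N ◁ Gal(E/K)` of prime index `p` containing every inertia group
  `I(𝔔)` (`𝔔` a maximal ideal of `𝓞 E`): `p ∣ h⁺(K)`.
* **`dvd_narrowClassNumber_of_isPGroup_of_dvd_narrowClassNumber`** — `L/K` a Galois `p`-extension of number fields in which every prime of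
  `L` not above the prime `v₀` of `K` is unramified (NO condition at infinity): `p ∣ h⁺(L) ⟹ p ∣ h⁺(K)`; contrapositive
  `not_dvd_narrowClassNumber_of_isPGroup`.

## References

* L. C. Washington, *Introduction to Cyclotomic Fields*, 2nd ed., GTM 83 (1997), Thm. 10.4, Prop. 13.22. [Washington1997]
* J. Neukirch, *Algebraic Number Theory* (1999), Ch. VI §6 Prop. (6.8). [NeukirchANT1999]
* R. Greenberg, LNM 1716 (1999), §5, proof of Prop. 5.14 (p. 122). [GreenbergLNM1716]
* J.-P. Serre, *Local Fields*, GTM 67 (1979), Ch. I §7, Prop. 21–22. [SerreLocalFields1979]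
-/

set_option autoImplicit false

noncomputable section

open NumberField IsDedekindDomain
open scoped IsMulCommutative Pointwise

namespace Literature.NumberTheory.NumberFields

/-! ### §1. An abelian extension of degree `p` unramified at the finite primes from a normal subgroup of index `p` -/

/-- **`p ∣ h⁺(K)` from a normal subgroup of index `p` containing all (finite) inertia groups.**  Let `E/K` be a Galois extension of number
fields and `N ◁ Gal(E/K)` a normal subgroup of prime index `p` containing the inertia group of every maximal ideal of `𝓞 E`.  Then the fixed
field of `N` is an abelian extension of `K` of degree `p` unramified at every finite prime, so `p ∣ h⁺(K)` (degree of a subextension of the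
big Hilbert class field). No hypothesis at the infinite places. [cite: Washington1997, Thm. 10.4 (proof)] [cite: NeukirchANT1999, Ch. VI §6 Prop. (6.8)] -/
theorem dvd_narrowClassNumber_of_normal_of_inertia_le {p : ℕ} [hp : Fact p.Prime] (K E : Type) [Field K]
    [NumberField K] [Field E] [NumberField E] [Algebra K E] [IsGalois K E]
    (N : Subgroup (E ≃ₐ[K] E)) [hNn : N.Normal]
    (hNi : N.index = p) (hIN : ∀ (Q : Ideal (𝓞 E)) [Q.IsMaximal], Q.inertia (E ≃ₐ[K] E) ≤ N) :
    p ∣ narrowClassNumber K := by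
  classical
  set F : IntermediateField K E := IntermediateField.fixedField N with hF
  haveI : IsGalois K F := IsGalois.of_fixedField_normal_subgroup N
  have hFdeg : Module.finrank K F = p := by
    have h1 := Module.finrank_mul_finrank K F E
    rw [hF, IntermediateField.finrank_fixedField_eq_card N] at h1
    have h2 : N.index * Nat.card N = Nat.card (E ≃ₐ[K] E) := N.index_mul_card
    rw [hNi, IsGalois.card_aut_eq_finrank] at h2
    rw [hF]
    exact Nat.eq_of_mul_eq_mul_right Nat.card_pos (h1.trans h2.symm)
  haveI : IsCyclic (F ≃ₐ[K] F) :=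
    isCyclic_of_prime_card (p := p) (by rw [IsGalois.card_aut_eq_finrank, hFdeg])
  haveI : IsAbelianGalois K F := { }
  have hunrF : ∀ v : HeightOneSpectrum (𝓞 K), Algebra.IsUnramifiedIn (𝓞 F) v.asIdeal := by
    intro v q hq hqv
    haveI := hq
    have hq0 : q ≠ ⊥ := by
      intro h0
      apply v.ne_bot
      rw [hqv.over, h0, Ideal.under_def, Ideal.comap_bot_of_injective _
        (FaithfulSMul.algebraMap_injective (𝓞 K) (𝓞 F))]
    haveI : q.IsMaximal := hq.isMaximal hq0
    obtain ⟨Q, hQmax, hQq⟩ := Ideal.exists_maximal_ideal_liesOver_of_isIntegral (S := 𝓞 E) q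
    haveI := hQmax
    have hq' : q = Q.under (𝓞 F) := hQq.over
    subst hq'
    rw [isUnramifiedAt_under_iff_inertia_le' F Q, hF, IntermediateField.fixingSubgroup_fixedField]
    exact hIN Q
  have hdvd := UnramifiedHomsOddNarrowClassNumber.finrank_dvd_narrowClassNumber_of_isUnramifiedIn (K := K) F hunrF
  rwa [hFdeg] at hdvd

/-! ### §2. Washington's Theorem 10.4 for the narrow class number -/

section Main

variable {p : ℕ} [hp : Fact p.Prime] (K L : Type) [Field K] [NumberField K] [Field L] [NumberField L]
  [Algebra K L] [IsGalois K L]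

/-- **Washington Thm. 10.4, NARROW form.**  Let `L/K` be a Galois extension of number fields whose group is a `p`-group and such that
every prime of `L` not above the prime `v₀` of `K` is unramified over `K` (at most one FINITE prime ramifies; the infinite places are
unrestricted).  If `p ∣ h⁺_L` then `p ∣ h⁺_K`.  Proof: the big Hilbert class field `E = K¹(L)` (degree `h⁺(L)`, unramified over `L` at every
finite prime) is Galois over `K`; `A = Gal(E/L)` is abelian with non-`p`-part `A₀ ◁ Gal(E/K)`; `G = Gal(E^{A₀}/K)` is a `p`-group; the inertia
group `I(𝔓₀)` of a prime over `v₀` meets `A` trivially, so `#I(𝔓₀) ≤ [L:K] < #G` and its image is proper, hence inside a normal subgroup of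
index `p`, which contains every inertia group (those over `v₀` by conjugacy, the others are trivial); §1.
[cite: Washington1997, Thm. 10.4] [cite: NeukirchANT1999, Ch. VI §6 Prop. (6.8)] [cite: GreenbergLNM1716, §5, proof of Prop. 5.14 (p. 122)] -/
theorem dvd_narrowClassNumber_of_isPGroup_of_dvd_narrowClassNumber (hG : IsPGroup p (L ≃ₐ[K] L))
    (v₀ : HeightOneSpectrum (𝓞 K))
    (hunr : ∀ (P : Ideal (𝓞 L)) [P.IsMaximal], P.under (𝓞 K) ≠ v₀.asIdeal →
      Algebra.IsUnramifiedAt (𝓞 K) P)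
    (hL : p ∣ narrowClassNumber L) : p ∣ narrowClassNumber K := by
  classical
  -- the big Hilbert class field `E = K¹(L)`, Galois over `K`
  set E := narrowRayClassField L (top_ne_bot : (⊤ : Ideal (𝓞 L)) ≠ ⊥) with hE
  haveI : IsGalois K E := narrowRayClassField.isGalois_of_isGalois L
  haveI : IsScalarTower K L E :=
    IsScalarTower.of_algebraMap_eq fun x => Subtype.ext (IsScalarTower.algebraMap_apply K L _ x)
  haveI : FiniteDimensional K E := Module.Finite.trans L E
  -- `E/L` is unramified at every finite prime
  have hEunr : ∀ (Q : Ideal (𝓞 E)) [Q.IsMaximal], Algebra.IsUnramifiedAt (𝓞 L) Q := by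
    intro Q hQ
    have hQ0 : Q ≠ ⊥ := Ring.ne_bot_of_isMaximal_of_not_isField hQ (RingOfIntegers.not_isField E)
    haveI : (Q.under (𝓞 L)).IsMaximal := Ideal.IsMaximal.under _ Q
    have hQL0 : Q.under (𝓞 L) ≠ ⊥ := mt Ideal.eq_bot_of_comap_eq_bot hQ0
    let v : HeightOneSpectrum (𝓞 L) := ⟨Q.under (𝓞 L), inferInstance, hQL0⟩
    have hv : ¬ (⊤ : Ideal (𝓞 L)) ≤ v.asIdeal := fun h => v.isPrime.ne_top (top_le_iff.mp h)
    exact isUnramifiedIn_narrowRayClassField (K := L) (top_ne_bot : (⊤ : Ideal (𝓞 L)) ≠ ⊥) hv Q inferInstance ⟨rfl⟩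
  -- `L' ≅ L` inside `E` and `A = Gal(E/L')`
  set L' : IntermediateField K E := (IsScalarTower.toAlgHom K L E).fieldRange with hL'
  let eL : L ≃ₐ[K] L' := AlgEquiv.ofInjectiveField (IsScalarTower.toAlgHom K L E)
  haveI : IsGalois K L' := IsGalois.of_algEquiv eL
  set A : Subgroup (E ≃ₐ[K] E) := L'.fixingSubgroup with hA
  haveI hAn : A.Normal := IsGalois.fixingSubgroup_normal_of_isGalois L'
  have hmemA : ∀ g : E ≃ₐ[K] E, g ∈ A ↔ ∀ l : L, g (algebraMap L E l) = algebraMap L E l := by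
    intro g
    rw [hA, IntermediateField.mem_fixingSubgroup_iff]
    constructor
    · intro h l; exact h _ ⟨l, rfl⟩
    · rintro h _ ⟨l, rfl⟩; exact h l
  -- elements of `A` as `L`-automorphisms; `A` is abelian
  have toL : ∀ g ∈ A, ∃ g' : E ≃ₐ[L] E, ∀ x, g' x = g x := fun g hg =>
    ⟨{ g with commutes' := fun l => (hmemA g).mp hg l }, fun x => rfl⟩
  have hAcomm : ∀ a ∈ A, ∀ b ∈ A, a * b = b * a := by
    intro a ha b hb
    obtain ⟨a', ha'⟩ := toL a ha
    obtain ⟨b', hb'⟩ := toL b hb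
    have := mul_comm a' b'
    apply AlgEquiv.ext
    intro x
    have h := congrArg (fun f : E ≃ₐ[L] E => f x) this
    simp only [AlgEquiv.mul_apply] at h ⊢
    rw [← ha', ← hb', h, hb', ha']
  -- `|A| = h⁺_L`
  have hAcard : Nat.card A = narrowClassNumber L := by
    rw [hA, IsGalois.card_fixingSubgroup_eq_finrank]
    have h1 := Module.finrank_mul_finrank K L' E
    have h2 := Module.finrank_mul_finrank K L E
    rw [← eL.toLinearEquiv.finrank_eq, ← h2] at h1
    have hpos : 0 < Module.finrank K L := Module.finrank_pos
    rw [← finrank_narrowRayClassField_top L]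
    exact Nat.eq_of_mul_eq_mul_left hpos h1
  -- the non-`p`-part `A₀` of `A`
  let A₀ : Subgroup (E ≃ₐ[K] E) :=
    { carrier := {g | g ∈ A ∧ ¬ p ∣ orderOf g}
      one_mem' := ⟨A.one_mem, by rw [orderOf_one, Nat.dvd_one]; exact hp.out.ne_one⟩
      mul_mem' := fun {a b} ha hb => ⟨A.mul_mem ha.1 hb.1, fun hdvd => by
        have hc : Commute a b := hAcomm a ha.1 b hb.1
        rcases (Nat.Prime.dvd_mul hp.out).mp (hdvd.trans hc.orderOf_mul_dvd_mul_orderOf) with h | h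
        · exact ha.2 h
        · exact hb.2 h⟩
      inv_mem' := fun {a} ha => ⟨A.inv_mem ha.1, by rw [orderOf_inv]; exact ha.2⟩ }
  have hA₀A : A₀ ≤ A := fun g hg => hg.1
  haveI hA₀n : A₀.Normal := ⟨fun n hn g => ⟨hAn.conj_mem n hn.1 g, by
    have : orderOf (g * n * g⁻¹) = orderOf n := by
      rw [show g * n * g⁻¹ = MulAut.conj g n from rfl]
      exact orderOf_injective (MulAut.conj g).toMonoidHom (MulAut.conj g).injective n
    rw [this]; exact hn.2⟩⟩
  -- `[A : A₀]` is a power of `p`, and `> 1` since `p ∣ |A|`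
  have hmemA₀ : ∀ g, g ∈ A₀ ↔ g ∈ A ∧ ¬ p ∣ orderOf g := fun g => Iff.rfl
  have hquot : IsPGroup p (A ⧸ A₀.subgroupOf A) := by
    intro q
    obtain ⟨a, rfl⟩ := QuotientGroup.mk_surjective q
    obtain ⟨m, c, hc, hmc⟩ := Nat.exists_eq_pow_mul_and_not_dvd
      (orderOf_pos (a : E ≃ₐ[K] E)).ne' p hp.out.ne_one
    refine ⟨m, ?_⟩
    rw [← QuotientGroup.mk_pow, QuotientGroup.eq_one_iff, Subgroup.mem_subgroupOf, hmemA₀,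
      Subgroup.coe_pow]
    refine ⟨A.pow_mem a.2 _, ?_⟩
    rw [orderOf_pow' _ (pow_ne_zero m hp.out.ne_zero), hmc, Nat.gcd_mul_right_left,
      Nat.mul_div_cancel_left _ (pow_pos hp.out.pos m)]
    exact hc
  obtain ⟨b, hb⟩ := IsPGroup.iff_card.mp hquot
  have hA₀card : Nat.card A = p ^ b * Nat.card A₀ := by
    rw [Subgroup.card_eq_card_quotient_mul_card_subgroup (A₀.subgroupOf A), hb,
      Nat.card_congr (Subgroup.subgroupOfEquivOfLe hA₀A).toEquiv]
  have hb0 : b ≠ 0 := by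
    rintro rfl
    rw [pow_zero, one_mul] at hA₀card
    -- then `A₀ = A`, contradicting Cauchy: an element of order `p` in `A`
    obtain ⟨a, ha⟩ := exists_prime_orderOf_dvd_card' (G := A) p (by rw [hAcard]; exact hL)
    have heq : A₀.subgroupOf A = ⊤ := by
      apply Subgroup.eq_top_of_card_eq
      rw [Nat.card_congr (Subgroup.subgroupOfEquivOfLe hA₀A).toEquiv, hA₀card]
    have hmem : a ∈ A₀.subgroupOf A := by rw [heq]; exact Subgroup.mem_top _
    rw [Subgroup.mem_subgroupOf, hmemA₀, Subgroup.orderOf_coe, ha] at hmem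
    exact hmem.2 dvd_rfl
  -- the fixed field `Hp` of `A₀`; `Gal(Hp/K)` is a `p`-group of order `p ^ (a + b)`
  set Hp : IntermediateField K E := IntermediateField.fixedField A₀ with hHp
  haveI : IsGalois K Hp := IsGalois.of_fixedField_normal_subgroup A₀
  obtain ⟨a, ha⟩ := IsPGroup.iff_card.mp hG
  have hfinKL : Module.finrank K L = p ^ a := by rw [← IsGalois.card_aut_eq_finrank, ha]
  have hGcard : Nat.card (E ≃ₐ[K] E) = p ^ a * Nat.card A := by
    rw [IsGalois.card_aut_eq_finrank, ← Module.finrank_mul_finrank K L E, hfinKL, hAcard,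
      finrank_narrowRayClassField_top L]
  have hindex : A₀.index = p ^ (a + b) := by
    have h1 := A₀.index_mul_card
    rw [hGcard, hA₀card, ← mul_assoc, ← pow_add] at h1
    exact Nat.eq_of_mul_eq_mul_right Nat.card_pos h1
  have hGp_card : Nat.card (Hp ≃ₐ[K] Hp) = p ^ (a + b) := by
    rw [← Nat.card_congr (IsGalois.normalAutEquivQuotient A₀).toEquiv, ← Subgroup.index_eq_card,
      hindex]
  have hGp : IsPGroup p (Hp ≃ₐ[K] Hp) := IsPGroup.of_card hGp_card
  -- restriction `res : Gal(E/K) → Gal(Hp/K)`, kernel `A₀`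
  set res : (E ≃ₐ[K] E) →* (Hp ≃ₐ[K] Hp) := AlgEquiv.restrictNormalHom Hp with hres
  have hres_surj : Function.Surjective res := AlgEquiv.restrictNormalHom_surjective E
  have hres_ker : res.ker = A₀ := by
    rw [hres, IntermediateField.restrictNormalHom_ker, hHp, IntermediateField.fixingSubgroup_fixedField]
  -- `L`-automorphisms among the inertia elements are trivial (`E/L` unramified at finite primes): `#I(Q) = e(Q ∩ L | K)`
  have hcardI : ∀ (Q : Ideal (𝓞 E)) [Q.IsMaximal],
      Nat.card (Q.inertia (E ≃ₐ[K] E)) = (Q.under (𝓞 L)).ramificationIdx (𝓞 K) := by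
    intro Q hQ
    rw [card_inertia_eq_ramificationIdx E (E ≃ₐ[K] E) K Q,
      Ideal.ramificationIdx_tower (Q.under (𝓞 L)) Q]
    haveI := hEunr Q
    rw [Ideal.ramificationIdx_eq_one Q (𝓞 L), mul_one]
  have hI_le : ∀ (Q : Ideal (𝓞 E)) [Q.IsMaximal],
      Nat.card (Q.inertia (E ≃ₐ[K] E)) ≤ Module.finrank K L := by
    intro Q hQ
    rw [hcardI Q]
    have hQ0 : Q ≠ ⊥ := Ring.ne_bot_of_isMaximal_of_not_isField ‹_› (RingOfIntegers.not_isField E)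
    haveI : (Q.under (𝓞 L)).IsMaximal := Ideal.IsMaximal.under _ Q
    have h0 : (Q.under (𝓞 L)).under (𝓞 K) ≠ ⊥ := by
      rw [Ideal.under_under]; exact mt Ideal.eq_bot_of_comap_eq_bot hQ0
    haveI : NoZeroSMulDivisors (𝓞 K) (𝓞 L) := ⟨fun {c x} h => by
      rw [Algebra.smul_def, mul_eq_zero] at h
      exact h.imp_left fun hc =>
        FaithfulSMul.algebraMap_injective (𝓞 K) (𝓞 L) (by rw [hc, map_zero])⟩
    rw [← Ideal.ramificationIdx'_eq_ramificationIdx ((Q.under (𝓞 L)).under (𝓞 K)) (Q.under (𝓞 L)) h0]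
    exact Ideal.ramificationIdx_le_finrank (S := 𝓞 L) (K := K) (L := L) (P := Q.under (𝓞 L))
  have hI_bot : ∀ (Q : Ideal (𝓞 E)) [Q.IsMaximal], Q.under (𝓞 K) ≠ v₀.asIdeal →
      Q.inertia (E ≃ₐ[K] E) = ⊥ := by
    intro Q hQ hne
    apply Subgroup.eq_bot_of_card_eq
    rw [hcardI Q]
    haveI : (Q.under (𝓞 L)).IsMaximal := Ideal.IsMaximal.under _ Q
    haveI := hunr (Q.under (𝓞 L)) (by rwa [Ideal.under_under])
    exact Ideal.ramificationIdx_eq_one _ _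
  -- a prime `P₀` of `E` above `v₀`; the image of `I(P₀)` in `Gal(Hp/K)` is a proper subgroup
  haveI : v₀.asIdeal.IsMaximal := v₀.isMaximal
  obtain ⟨P₀, hP₀max, hP₀v⟩ :=
    Ideal.exists_maximal_ideal_liesOver_of_isIntegral (S := 𝓞 E) v₀.asIdeal
  haveI := hP₀max
  haveI := hP₀v
  set I₀ : Subgroup (E ≃ₐ[K] E) := P₀.inertia (E ≃ₐ[K] E) with hI₀
  have hproper : I₀.map res ≠ ⊤ := by
    intro htop
    have h1 : Nat.card (I₀.map res) ≤ Nat.card I₀ :=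
      Nat.card_le_card_of_surjective (fun x : I₀ => ⟨res x, Subgroup.mem_map_of_mem res x.2⟩)
        (by rintro ⟨_, x, hx, rfl⟩; exact ⟨⟨x, hx⟩, rfl⟩)
    rw [htop, Subgroup.card_top, hGp_card] at h1
    have h2 : Nat.card I₀ ≤ p ^ a := hfinKL ▸ hI_le P₀
    have h3 : p ^ a < p ^ (a + b) := Nat.pow_lt_pow_right hp.out.one_lt (by omega)
    omega
  obtain ⟨N', hN'n, hN'i, hIN'⟩ := exists_normal_index_eq_of_isPGroup hGp (I₀.map res) hproper
  -- pull the normal subgroup back to `Gal(E/K)`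
  set N : Subgroup (E ≃ₐ[K] E) := N'.comap res with hN
  haveI hNn : N.Normal := hN'n.comap res
  have hNi : N.index = p := by rw [hN, N'.index_comap_of_surjective hres_surj, hN'i]
  have hI₀N : I₀ ≤ N := by rw [hN, ← Subgroup.map_le_iff_le_comap]; exact hIN'
  -- every inertia group lies in `N`
  have hIN : ∀ (Q : Ideal (𝓞 E)) [Q.IsMaximal], Q.inertia (E ≃ₐ[K] E) ≤ N := by
    intro Q hQ
    by_cases hQv : Q.under (𝓞 K) = v₀.asIdeal
    · haveI : Q.LiesOver v₀.asIdeal := ⟨hQv.symm⟩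
      obtain ⟨g, hg⟩ := Ideal.exists_smul_eq_of_isGaloisGroup v₀.asIdeal P₀ Q (E ≃ₐ[K] E)
      rw [← hg, inertia_smul_eq_map_conj, Subgroup.map_le_iff_le_comap]
      intro x hx
      exact hNn.conj_mem x (hI₀N hx) g
    · rw [hI_bot Q hQv]; exact bot_le
  -- conclude with the fixed field of `N`
  exact dvd_narrowClassNumber_of_normal_of_inertia_le K E N hNi hIN

/-- **Contrapositive (Iwasawa's lemma, narrow form): `p ∤ h⁺(K) ⟹ p ∤ h⁺(L)`** for a Galois `p`-extension `L/K` ramified at no finite prime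
outside `v₀` — e.g. `p = 2`, `K` totally real with odd narrow class number, `L/K` a layer of a `ℤ₂`-extension with one prime above `2`.
[cite: Washington1997, Thm. 10.4 and Prop. 13.22] [cite: GreenbergLNM1716, §5, proof of Prop. 5.14 (p. 122)] -/
theorem not_dvd_narrowClassNumber_of_isPGroup (hG : IsPGroup p (L ≃ₐ[K] L)) (v₀ : HeightOneSpectrum (𝓞 K))
    (hunr : ∀ (P : Ideal (𝓞 L)) [P.IsMaximal], P.under (𝓞 K) ≠ v₀.asIdeal →
      Algebra.IsUnramifiedAt (𝓞 K) P)
    (hK : ¬ p ∣ narrowClassNumber K) : ¬ p ∣ narrowClassNumber L :=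
  fun hL => hK (dvd_narrowClassNumber_of_isPGroup_of_dvd_narrowClassNumber K L hG v₀ hunr hL)

end Main

end Literature.NumberTheory.NumberFields

end
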